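import Literature.AlgebraicGeometry.Resolution.QuadraticSequenceDimOne
import Literature.RingTheory.DiscreteValuationRing.DeligneSerreLiftingProofs
import Mathlib.RingTheory.Localization.AsSubring
import Mathlib.RingTheory.DedekindDomain.Dvr
import HarnessLib

/-!
# The quadratic sequence of a one-dimensional Noetherian local domain exists, and the valuation
# ring of a maximal ideal of a finite normalization (Herrmann–Ikeda–Orbanz, proof of Thm. (30.2))

Topic: `Literature/AlgebraicGeometry/Resolution`. Complements to `QuadraticSequenceDimOne.lean`
(Herrmann–Ikeda–Orbanz, *Equimultiplicity and Blowing up*, proof of Thm. (30.2), the curve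
`R̄ = R/𝔭`): there the sequence `R̄ = A₀ → A₁ → ⋯` of quadratic transforms along a valuation ring
`O` and the data "`O = N_n` with `N ⊇ A₀` finitely generated" are hypotheses. This file PROVES:

* `isNoetherianRing_of_le`, `dimensionLEOne_of_le` — **Krull–Akizuki for subrings of `K`**: every
  subring `B` with `A ≤ B ≤ K`, `A` a one-dimensional Noetherian local domain with fraction field
  `K`, is Noetherian of dimension `≤ 1` (`KrullAkizuki_holds`, Matsumura Thm. 11.7);
* `quadraticSeq`, `isQuadraticTransformAlong_quadraticSeq` — hence **the sequence of quadratic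
  transforms of `A` along any valuation ring `O` dominating `A` exists** (each member is again
  Noetherian, local, not a field, so its maximal ideal is finitely generated and nonzero and
  `exists_isLocalBlowupAlong` applies);
* `exists_valuationSubring_dominates_of_finite_integralClosure` — **"`V = N_n`"**: if the integral
  closure `N` of `A` in `K` is a finite `A`-module (HIO: "Now we use the excellence of `R`. Then
  `N` is a finite `R̄`-module"), then for the localization `O = N_n` of `N` at a maximal ideal `n`
  (a discrete valuation ring: `N` is Dedekind by Krull–Akizuki) one has: `O` is a valuation ring
  of `K` dominating `A`, `N ⊆ O` is generated over `A` by finitely many elements, and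
  `O ⊆ N_{𝔪_O ∩ N}` — exactly the hypotheses of `exists_sequence_eq_valuationSubring`;
* `exists_quadraticSeq_eq_valuationSubring` — so **the quadratic sequence of `A` along `O`
  reaches `O`: `A_c = O` for some `c`**, and `O` is a discrete valuation ring.

No named facts are introduced; `quadraticSeq` is a definition by recursion (choice of the
transform along `O`, which is unique by `IsQuadraticTransformAlong.unique`).

## Sources

* M. Herrmann, S. Ikeda, U. Orbanz, *Equimultiplicity and Blowing up*, Springer 1988, Ch. VI,
  proof of Thm. (30.2), p. 251–252. [HerrmannIkedaOrbanz1988]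
* H. Matsumura, *Commutative Ring Theory*, Thm. 11.7 and its Corollary (Krull–Akizuki).
  [Matsumura1987]
-/

noncomputable section

namespace Literature.AlgebraicGeometry.Resolution

universe u

variable {K : Type u} [Field K]

open IsLocalRing Literature.RingTheory.DiscreteValuationRing

/-! ## Krull–Akizuki for subrings of `K` -/

section KrullAkizuki

variable {A : Subring K} [IsNoetherianRing A] [Ring.KrullDimLE 1 A]

omit [IsNoetherianRing A] in
/-- A one-dimensional domain has `DimensionLEOne`. [folklore] -/
theorem dimensionLEOne_subring : Ring.DimensionLEOne A :=
  ⟨fun h1 h2 => Ring.krullDimLE_one_iff_of_isPrime_bot.mp inferInstance _ h1 h2⟩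

/-- A subring `B ⊇ A` as an `A`-subalgebra of `K`. [folklore] -/
def subalgebraOfLE {A B : Subring K} (hAB : A ≤ B) : Subalgebra A K :=
  { B.toSubsemiring with
    algebraMap_mem' := fun a => hAB a.2 }

/-- The identity `subalgebraOfLE hAB ≃+* B`. [folklore] -/
def subalgebraOfLEEquiv {A B : Subring K} (hAB : A ≤ B) : subalgebraOfLE hAB ≃+* B :=
  { toFun := fun x => ⟨x.1, x.2⟩
    invFun := fun x => ⟨x.1, x.2⟩
    left_inv := fun _ => rfl
    right_inv := fun _ => rfl
    map_mul' := fun _ _ => rfl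
    map_add' := fun _ _ => rfl }

/-- **Krull–Akizuki for subrings**: a subring `B` of `K` containing a one-dimensional Noetherian
local domain `A` with fraction field `K`, `A` not a field, is Noetherian …
[cite: Matsumura1987, Thm. 11.7] -/
theorem isNoetherianRing_of_le (hof : IsLocalRingOf A) (hA : ¬ IsField A) {B : Subring K}
    (hAB : A ≤ B) : IsNoetherianRing B := by
  haveI : IsFractionRing A K := isFractionRing_of_isLocalRingOf_le hof.2 le_rfl
  haveI : Ring.DimensionLEOne A := dimensionLEOne_subring
  obtain ⟨hN, -, -⟩ := KrullAkizuki_holds hA (K := K) (L := K) (subalgebraOfLE hAB)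
  exact isNoetherianRing_of_ringEquiv _ (subalgebraOfLEEquiv hAB)

/-- … and of dimension `≤ 1`. [cite: Matsumura1987, Thm. 11.7] -/
theorem dimensionLEOne_of_le (hof : IsLocalRingOf A) (hA : ¬ IsField A) {B : Subring K}
    (hAB : A ≤ B) : Ring.DimensionLEOne B := by
  haveI : IsFractionRing A K := isFractionRing_of_isLocalRingOf_le hof.2 le_rfl
  haveI : Ring.DimensionLEOne A := dimensionLEOne_subring
  obtain ⟨-, hD, -⟩ := KrullAkizuki_holds hA (K := K) (L := K) (subalgebraOfLE hAB)
  exact Ring.DimensionLEOne.of_ringEquiv (subalgebraOfLEEquiv hAB).symm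

end KrullAkizuki

/-! ## Existence of the quadratic sequence along `O` -/

section Sequence

variable {O : ValuationSubring K}

/-- A local subring `B ⊇ A` dominated by `O`, where `A` is dominated by `O` and is not a field, is
not a field (a nonzero `a ∈ 𝔪_A` would become a unit of `B ⊆ O`, hence of `A`). [folklore] -/
theorem maximalIdeal_ne_bot_of_subringDominates {A B : Subring K} [IsLocalRing A] [IsLocalRing B]
    (hA : ¬ IsField A) (h0 : SubringDominates A O.toSubring) (hAB : A ≤ B)
    (hBO : B ≤ O.toSubring) : maximalIdeal B ≠ ⊥ := by
  intro hB
  apply hA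
  rw [IsLocalRing.isField_iff_maximalIdeal_eq]
  rw [eq_bot_iff]
  intro a ha
  by_contra ha0
  have ha0' : (a : K) ≠ 0 := fun h => ha0 (by exact_mod_cast h)
  -- `a` is a unit of `B` (else `a ∈ 𝔪_B = 0`), so `a⁻¹ ∈ B ⊆ O`, so `a⁻¹ ∈ A`
  have haB : IsUnit (⟨a, hAB a.2⟩ : B) := by
    by_contra hu
    have : (⟨a, hAB a.2⟩ : B) ∈ maximalIdeal B := hu
    rw [hB] at this
    exact ha0' (congrArg Subtype.val this)
  have hinvB : (a : K)⁻¹ ∈ B := ((isUnit_subring_iff_inv_mem _).mp haB).2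
  have hinvA : (a : K)⁻¹ ∈ A := h0.2 a a.2 (hBO hinvB)
  exact ha ((isUnit_subring_iff_inv_mem a).mpr ⟨ha0', hinvA⟩) |> fun h => h.elim

/-- **Existence of the quadratic transform along `O`** of a Noetherian local subring `B ⊆ O`
which is not a field. [cite: HerrmannIkedaOrbanz1988, Thm. (30.2) (proof)] -/
theorem exists_isQuadraticTransformAlong {B : Subring K} [IsLocalRing B] [IsNoetherianRing B]
    (hBO : B ≤ O.toSubring) (hB : maximalIdeal B ≠ ⊥) :
    ∃ B₁ : Subring K, IsQuadraticTransformAlong O B B₁ := by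
  obtain ⟨B₁, h⟩ := exists_isLocalBlowupAlong hBO (maximalIdeal B) (IsNoetherian.noetherian _) hB
  exact ⟨B₁, ‹IsLocalRing B›, h⟩

variable (O)

/-- **The sequence of quadratic transforms of `A` along `O`** (`A_{k+1}` = the quadratic
transform of `A_k` along `O` if it exists, else `A_k`). [cite: HerrmannIkedaOrbanz1988, Thm. (30.2) (proof)] -/
def quadraticSeq (A : Subring K) : ℕ → Subring K
  | 0 => A
  | k + 1 => by
    classical
    exact if h : ∃ B, IsQuadraticTransformAlong O (quadraticSeq A k) B then h.choose
      else quadraticSeq A k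

/-- `A_0 = A`. [folklore] -/
@[simp] theorem quadraticSeq_zero (A : Subring K) : quadraticSeq O A 0 = A := rfl

variable {O}

/-- The successor is the transform whenever one exists. [folklore] -/
theorem quadraticSeq_succ_of_exists {A : Subring K} {k : ℕ}
    (h : ∃ B, IsQuadraticTransformAlong O (quadraticSeq O A k) B) :
    IsQuadraticTransformAlong O (quadraticSeq O A k) (quadraticSeq O A (k + 1)) := by
  classical
  have : quadraticSeq O A (k + 1) = h.choose := by
    show (if h : ∃ B, IsQuadraticTransformAlong O (quadraticSeq O A k) B then h.choose
      else quadraticSeq O A k) = h.choose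
    rw [dif_pos h]
  rw [this]
  exact h.choose_spec

/-- **The quadratic sequence of a one-dimensional Noetherian local domain along a dominating
valuation ring is an infinite sequence of quadratic transforms**: every member is local,
dominated by `O`, Noetherian (Krull–Akizuki) and not a field, so the next transform exists.
[cite: HerrmannIkedaOrbanz1988, Thm. (30.2) (proof)] -/
theorem isQuadraticTransformAlong_quadraticSeq {A : Subring K} [IsNoetherianRing A]
    [Ring.KrullDimLE 1 A] (hof : IsLocalRingOf A) (hA : ¬ IsField A)
    (h0 : SubringDominates A O.toSubring) (k : ℕ) :
    IsQuadraticTransformAlong O (quadraticSeq O A k) (quadraticSeq O A (k + 1)) := by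
  haveI : IsLocalRing A := hof.1
  -- invariant: `A_k` is local, contains `A`, and is dominated by `O`
  have inv : ∀ k, ∃ _ : IsLocalRing (quadraticSeq O A k), A ≤ quadraticSeq O A k ∧
      SubringDominates (quadraticSeq O A k) O.toSubring ∧
      IsQuadraticTransformAlong O (quadraticSeq O A k) (quadraticSeq O A (k + 1)) := by
    intro k
    induction k with
    | zero =>
      haveI : IsLocalRing (quadraticSeq O A 0) := hof.1
      haveI : IsNoetherianRing (quadraticSeq O A 0) := ‹IsNoetherianRing A›
      refine ⟨‹_›, le_rfl, h0, ?_⟩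
      exact quadraticSeq_succ_of_exists (exists_isQuadraticTransformAlong h0.1
        (maximalIdeal_ne_bot_of_subringDominates (B := quadraticSeq O A 0) hA h0 le_rfl h0.1))
    | succ k ih =>
      obtain ⟨_, hAk, hdomk, hstepk⟩ := ih
      haveI : IsLocalRing (quadraticSeq O A (k + 1)) := hstepk.isLocalRing
      have hA1 : A ≤ quadraticSeq O A (k + 1) := hAk.trans hstepk.le
      have hdom1 : SubringDominates (quadraticSeq O A (k + 1)) O.toSubring := hstepk.dominated
      refine ⟨‹_›, hA1, hdom1, ?_⟩
      haveI : IsNoetherianRing (quadraticSeq O A (k + 1)) := isNoetherianRing_of_le hof hA hA1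
      exact quadraticSeq_succ_of_exists (exists_isQuadraticTransformAlong hdom1.1
        (maximalIdeal_ne_bot_of_subringDominates hA h0 hA1 hdom1.1))
  exact (inv k).2.2.2

end Sequence

/-! ## The valuation ring `N_n` of a maximal ideal of a finite normalization -/

section Normalization

variable {A : Subring K} [IsNoetherianRing A] [Ring.KrullDimLE 1 A]

/-- **`V = N_n`** (Herrmann–Ikeda–Orbanz, proof of Thm. (30.2)). Let `A ⊆ K` be a one-dimensional
Noetherian local domain with fraction field `K`, not a field, whose integral closure `N` in `K` is
a finite `A`-module. Then there is a valuation ring `O` of `K` (the localization `N_n` at a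
maximal ideal `n` of the Dedekind domain `N`, a discrete valuation ring) dominating `A`, such that
`N ⊆ O` is generated over `A` by a finite set and `O ⊆ N_{𝔪_O ∩ N}`.
[cite: HerrmannIkedaOrbanz1988, Thm. (30.2) (proof)] [cite: Matsumura1987, Cor. to Thm. 11.7] -/
theorem exists_valuationSubring_dominates_of_finite_integralClosure (hof : IsLocalRingOf A)
    (hA : ¬ IsField A) (hfin : Module.Finite A (integralClosure A K)) :
    ∃ O : ValuationSubring K, IsDiscreteValuationRing O ∧ SubringDominates A O.toSubring ∧
      ∃ (N : Subring K) (S : Finset K), N ≤ O.toSubring ∧ (S : Set K) ⊆ N ∧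
        N ≤ Subring.closure ((A : Set K) ∪ ↑S) ∧ O.toSubring ≤ locAtCentre N O := by
  classical
  haveI : IsLocalRing A := hof.1
  haveI : IsFractionRing A K := isFractionRing_of_isLocalRingOf_le hof.2 le_rfl
  haveI : Ring.DimensionLEOne A := dimensionLEOne_subring
  haveI : IsDedekindDomain (integralClosure A K) :=
    KrullAkizuki_holds.isDedekindDomain_integralClosure hA K K
  have hinj : Function.Injective (algebraMap A (integralClosure A K)) := fun x y hxy =>
    Subtype.ext (congrArg (fun c : integralClosure A K => (c : K)) hxy)
  -- a maximal ideal `Q` of the normalization over `𝔪_A`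
  obtain ⟨Q, hQmax, hQ⟩ := Ideal.exists_ideal_over_maximal_of_isIntegral
    (S := integralClosure A K) (maximalIdeal A)
    (by rw [(RingHom.injective_iff_ker_eq_bot _).mp hinj]; exact bot_le)
  have hQne : Q ≠ ⊥ := by
    rintro rfl
    refine Ring.ne_bot_of_isMaximal_of_not_isField (IsLocalRing.maximalIdeal.isMaximal A) hA ?_
    rw [← hQ, Ideal.comap_bot_of_injective _ hinj]
  haveI := hQmax.isPrime
  -- `O = N_Q ⊆ K`, a discrete valuation ring
  let 𝒪 : Subalgebra (integralClosure A K) K :=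
    Localization.subalgebra.ofField K Q.primeCompl Q.primeCompl_le_nonZeroDivisors
  haveI : IsLocalization.AtPrime 𝒪 Q := Localization.subalgebra.isLocalization_ofField K _ _
  haveI : IsDiscreteValuationRing 𝒪 :=
    IsLocalization.AtPrime.isDiscreteValuationRing_of_dedekind_domain _ hQne 𝒪
  have hC𝒪 : ∀ c : integralClosure A K, (c : K) ∈ 𝒪 := fun c => 𝒪.algebraMap_mem c
  have hA𝒪 : ∀ a : A, (a : K) ∈ 𝒪 := fun a => hC𝒪 (algebraMap A (integralClosure A K) a)
  haveI : IsFractionRing 𝒪 K := by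
    refine IsFractionRing.of_field 𝒪 K fun z => ?_
    obtain ⟨a, ha, b, hb, -, rfl⟩ := hof.2 z
    exact ⟨⟨a, hA𝒪 ⟨a, ha⟩⟩, ⟨b, hA𝒪 ⟨b, hb⟩⟩, rfl⟩
  have hmem_or : ∀ z : K, z ∈ 𝒪 ∨ z⁻¹ ∈ 𝒪 := by
    intro z
    rcases ValuationRing.isInteger_or_isInteger 𝒪 z with ⟨y, hy⟩ | ⟨y, hy⟩
    · exact Or.inl (hy ▸ y.2)
    · exact Or.inr (hy ▸ y.2)
  let O : ValuationSubring K :=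
    { 𝒪.toSubring with
      mem_or_inv_mem' := hmem_or }
  -- an element of `N` whose inverse lies in `O` lies outside `Q`
  have hunitC : ∀ c : integralClosure A K, (c : K) ≠ 0 → (c : K)⁻¹ ∈ O → c ∉ Q := by
    intro c hc0 hc hcQ
    have hu : IsUnit (algebraMap (integralClosure A K) 𝒪 c) := by
      rw [isUnit_iff_exists_inv]
      exact ⟨⟨(c : K)⁻¹, hc⟩, Subtype.ext (mul_inv_cancel₀ hc0)⟩
    exact (IsLocalization.AtPrime.isUnit_to_map_iff 𝒪 Q c).mp hu hcQ
  -- generators of `N` over `A`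
  obtain ⟨s, hs⟩ := Module.Finite.fg_top (R := A) (M := integralClosure A K)
  have hdvr : IsDiscreteValuationRing O :=
    IsDiscreteValuationRing.RingEquivClass.isDiscreteValuationRing (A := 𝒪) (B := O)
      ({ toFun := fun x => ⟨x.1, x.2⟩, invFun := fun x => ⟨x.1, x.2⟩, left_inv := fun _ => rfl,
         right_inv := fun _ => rfl, map_mul' := fun _ _ => rfl, map_add' := fun _ _ => rfl } :
        𝒪 ≃+* O)
  refine ⟨O, hdvr, ⟨fun a ha => hA𝒪 ⟨a, ha⟩, fun a ha hainv => ?_⟩, (integralClosure A K).toSubring,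
    s.image (fun c : integralClosure A K => (c : K)), ?_, ?_, ?_, ?_⟩
  · -- domination: `a⁻¹ ∈ O` forces `a ∉ 𝔪_A`, so `a` is a unit of `A`
    by_cases ha0 : a = 0
    · rw [ha0, inv_zero]; exact A.zero_mem
    · have haQ : algebraMap A (integralClosure A K) ⟨a, ha⟩ ∉ Q := hunitC _ ha0 hainv
      have ham : (⟨a, ha⟩ : A) ∉ maximalIdeal A := by rw [← hQ]; exact haQ
      have hu : IsUnit (⟨a, ha⟩ : A) := by
        by_contra h
        exact ham h
      exact ((isUnit_subring_iff_inv_mem _).mp hu).2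
  · -- `N ⊆ O`
    intro c hc
    exact hC𝒪 ⟨c, hc⟩
  · -- `S ⊆ N`
    intro x hx
    rw [Finset.coe_image] at hx
    obtain ⟨c, -, rfl⟩ := hx
    exact c.2
  · -- `N ⊆ A[S]`
    have key : ∀ x ∈ Submodule.span A (s : Set (integralClosure A K)),
        (x : K) ∈ Subring.closure ((A : Set K) ∪ ↑(s.image fun c : integralClosure A K => (c : K))) := by
      intro x hx
      induction hx using Submodule.span_induction with
      | mem x hx =>
        refine Subring.subset_closure (Or.inr ?_)
        rw [Finset.coe_image]
        exact ⟨x, hx, rfl⟩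
      | zero => exact Subring.zero_mem _
      | add x y _ _ hx hy => exact Subring.add_mem _ hx hy
      | smul a x _ hx =>
        change ((a : K) * (x : K)) ∈ _
        exact Subring.mul_mem _ (Subring.subset_closure (Or.inl a.2)) hx
    intro c hc
    have hcmem : (⟨c, hc⟩ : integralClosure A K) ∈ Submodule.span A (s : Set (integralClosure A K)) := by
      rw [hs]; exact Submodule.mem_top
    exact key _ hcmem
  · -- `O ⊆ N_{𝔪_O ∩ N}`
    intro z hz
    obtain ⟨a, t, ht, rfl⟩ := (show z ∈ 𝒪 from hz)
    refine ⟨(a : K), a.2, (t : K), t.2, ?_, by rw [div_eq_mul_inv]; rfl⟩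
    -- `t ∉ Q` is a unit of `O`
    have hu : IsUnit (algebraMap (integralClosure A K) 𝒪 t) :=
      (IsLocalization.AtPrime.isUnit_to_map_iff 𝒪 Q t).mpr ht
    have huO : IsUnit (⟨(t : K), hC𝒪 t⟩ : O) := by
      obtain ⟨w, hw⟩ := isUnit_iff_exists_inv.mp hu
      exact isUnit_iff_exists_inv.mpr ⟨⟨(w : K), w.2⟩, Subtype.ext (congrArg Subtype.val hw)⟩
    exact (O.valuation_eq_one_iff _).mp huO

/-- **The quadratic sequence of a one-dimensional Noetherian local domain with finite
normalization reaches a discrete valuation ring** (Herrmann–Ikeda–Orbanz, proof of Thm. (30.2):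
"`R̄^{(c)} = N_n = V`. Therefore `R̄^{(c)}` is regular"): for `A ⊆ K` as above there are a discrete
valuation ring `O` of `K` dominating `A` and `c` with `A_c = O` along the sequence
`A = A₀ → A₁ → ⋯` of quadratic transforms of `A` along `O`.
[cite: HerrmannIkedaOrbanz1988, Thm. (30.2) (proof)] -/
theorem exists_quadraticSeq_eq_valuationSubring (hof : IsLocalRingOf A) (hA : ¬ IsField A)
    (hfin : Module.Finite A (integralClosure A K)) :
    ∃ O : ValuationSubring K, IsDiscreteValuationRing O ∧ SubringDominates A O.toSubring ∧
      (∀ k, IsQuadraticTransformAlong O (quadraticSeq O A k) (quadraticSeq O A (k + 1))) ∧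
      ∃ c, quadraticSeq O A c = O.toSubring := by
  obtain ⟨O, hdvr, h0, N, S, hNO, hSN, hNS, hON⟩ :=
    exists_valuationSubring_dominates_of_finite_integralClosure hof hA hfin
  have hstep := isQuadraticTransformAlong_quadraticSeq (O := O) hof hA h0
  haveI : IsNoetherianRing (quadraticSeq O A 0) := ‹IsNoetherianRing A›
  haveI : Ring.KrullDimLE 1 (quadraticSeq O A 0) := ‹Ring.KrullDimLE 1 A›
  exact ⟨O, hdvr, h0, hstep,
    exists_sequence_eq_valuationSubring (A := quadraticSeq O A) hof h0 hstep hNO S hSN hNS hON⟩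

end Normalization

end Literature.AlgebraicGeometry.Resolution
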